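import Mathlib
import HarnessLib
import Summits.PneNP.Statement
import Summits.PneNP.PneNP.Theses.RootDecompEfProver
import Summits.PneNP.PneNP.Theorems.EfNotPOptimalEFProofSearchOfCollapse
import Literature.Computability.MetaComplexity.Frege
import Literature.Computability.Complexity.ProofComplexityNP
import Literature.Computability.Complexity.StringCopy
import Literature.Computability.Complexity.ReductionsProofs
import Literature.Computability.Complexity.BrickAlgebra
import Literature.Computability.Complexity.NondeterministicProofs
import Literature.Computability.Complexity.CookBridges

/-!
# `PneNP → RootDecompEfProver.NoFPProverEF` — necessity of piece A of route RootDecompEfProver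

decomp-pnenp · lens 5 · g12 · LANDING-READY support file for stmt-PneNP-23777 (`NoFPProverEF`), the item
«S ⟹ NoFPProverEF» of the CYCLE-2 ORDER's provable-now list (2026-08-30T09:51:31Z, flag 2).

If some Frege system `F` had a polynomial-time EF-prover `g ∈ FP` (for every tautology `φ`, `g (encode φ)` is
a certificate accepted by the tree's EF-certificate checker `EFProofSearch.chkFn F`), then
`TAUT = {x | tautVerifierFn (efV F) (boolPair x (g x)) = [true]} ∈ P` — completeness of `chkFn` on the
prover's output, and SOUNDNESS of extended Frege (Cook–Reckhow 1979 Prop. 4.2, proved inline below) for the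
converse inclusion — hence `NP ⊆ P` (`TAUT` is `coNP`-hard: Cook–Levin, `CookLevin.isHard_coNP_TAUT_holds`;
`P` is closed under complement and Karp reductions) and `¬ PneNP` along the Clay bridges
(`CookBridges.np_bool_eq`, `p_bool_eq`).  So `PneNP → NoFPProverEF`: piece A is S-implied (WEAKER).

Main results: `noFPProverEF_of_pneNP : PneNP → RootDecompEfProver.NoFPProverEF`;
`TAUT_mem_P_of_prover`; EF soundness (Cook–Reckhow Prop. 4.2) is proved inline inside `efSys_sound` (the tree's `FregeSystem.IsSound.isTautology_of_isEFProofOf` states it, module unbuilt on the farm at landing time).  No `sorry`, no new axioms, no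
instances, no notation.  Extracted from the lens-5 g12 node `EfCurrencySeam.lean` (Parts B2–B3).
-/

set_option linter.dupNamespace false
set_option linter.unusedVariables false

namespace Summit.PneNP.PneNP.Theorems.RootDecompEfProverNoFPProverEFOfPneNP

open _root_.Computability
open Literature.Computability.Complexity Literature.Computability.MetaComplexity
open Literature.Computability.Complexity.PropForm (IsTautology)
open Summit.PneNP.PneNP.Theorems.EFProofSearch
open Summit.PneNP.PneNP.Theses (RootDecompEfProver.NoFPProverEF)
open Literature.PNP

section Soundness

/-! ### EF soundness, inline (Cook–Reckhow 1979 Prop. 4.2; proof = `EFSoundness.lean` /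
`EfProverLadder.lean` §II.1 of this lineage, reproduced so that this file is hypothesis-free). -/

/-- Evaluation ignores updates at variables not occurring in the formula. [folklore] -/
theorem eval_update_of_not_mem_vars {φ : PropForm ℕ} {x : ℕ} (hx : x ∉ φ.vars)
    (τ : ℕ → Bool) (b : Bool) : φ.eval (Function.update τ x b) = φ.eval τ := by
  induction φ with
  | var y =>
    have hxy : y ≠ x := fun h => hx (by simp [PropForm.vars, h])
    simp [PropForm.eval, Function.update_of_ne hxy]
  | const c => rfl
  | neg φ ih => simp only [PropForm.eval, ih (by simpa [PropForm.vars] using hx)]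
  | conj φ ψ ihφ ihψ =>
    simp only [PropForm.vars, Finset.mem_union, not_or] at hx
    simp only [PropForm.eval, ihφ hx.1, ihψ hx.2]
  | disj φ ψ ihφ ihψ =>
    simp only [PropForm.vars, Finset.mem_union, not_or] at hx
    simp only [PropForm.eval, ihφ hx.1, ihψ hx.2]

end Soundness


section Verifier

/-- The extended-Frege certificate checker of the tree in Cook–Reckhow verifier form (as in the lineage's
g5/g12 nodes, verbatim). -/
noncomputable def efV (F : FregeSystem) : List Bool → List Bool → Bool := fun x c =>
  ({z | chkFn F z = [true]} : Set (List Bool)).boolIndicator (boolPair x c)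

/-- The EF proof system over `F` with non-codewords rejected. -/
noncomputable def efSys (F : FregeSystem) : List Bool → List Bool → Bool := tautVerifier (efV F)

/-- The EF verifier accepts `(x, c)` iff the tree's certificate checker accepts the paired code. -/
theorem efV_eq_true_iff (F : FregeSystem) (x c : List Bool) :
    efV F x c = true ↔ chkFn F (boolPair x c) = [true] :=
  (Set.mem_iff_boolIndicator _ _).symm

/-- The EF proof system accepts `(x, c)` iff `x` is a formula code and the checker accepts the paired code. -/
theorem efSys_eq_true_iff (F : FregeSystem) (x c : List Bool) :
    efSys F x c = true ↔ chkTaut x [] = false ∧ chkFn F (boolPair x c) = [true] := by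
  show (!(chkTaut x []) && efV F x c) = true ↔ _
  rw [Bool.and_eq_true, Bool.not_eq_true', efV_eq_true_iff]

/-- The EF verifier is polynomial-time (the checker's language is in `P`). -/
theorem isPolyTimeVerifier_efV (F : FregeSystem) : IsPolyTimeVerifier (efV F) := by
  obtain ⟨p, M, hM⟩ := indicatorFn_mem_FP (chkLang_mem_P F)
  exact ⟨p, M, fun a => hM (boolPair a.1 a.2)⟩

/-- Soundness of the EF verifier for Frege `F` (EF soundness, Cook–Reckhow 1979 Prop. 4.2, inline). [cite: CookReckhow1979, Prop. 4.2] -/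
theorem efSys_sound {F : FregeSystem} (hF : IsFrege F) {x c : List Bool}
    (h : efSys F x c = true) : x ∈ TAUT := by
  obtain ⟨h0, hc⟩ := (efSys_eq_true_iff F x c).1 h
  obtain ⟨φ, rfl⟩ := mem_range_encode_of_chkTaut_nil h0
  -- EF soundness (Cook–Reckhow 1979, Prop. 4.2), proved inline: the tree's
  -- `FregeSystem.IsSound.exists_eval_of_isEFDerivation` (Literature/…/EFSoundness.lean) states exactly
  -- this, but its module is not built on the farm at landing time, so the argument is re-run locally.
  have key : ∀ (π : List (PropForm ℕ)) (φ : PropForm ℕ), F.IsSound → F.IsEFDerivation φ π →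
      ∀ τ : ℕ → Bool, ∃ τ' : ℕ → Bool, φ.eval τ' = φ.eval τ ∧ ∀ θ ∈ π, θ.eval τ' = true := by
    intro π φ hF h τ
    suffices H : ∀ k ≤ π.length, ∃ τ' : ℕ → Bool, φ.eval τ' = φ.eval τ ∧
        ∀ (j : ℕ) (hj : j < π.length), j < k → π[j].eval τ' = true by
      obtain ⟨τ', hφ, hπ⟩ := H π.length le_rfl
      refine ⟨τ', hφ, fun θ hθ => ?_⟩
      obtain ⟨j, hj, rfl⟩ := List.getElem_of_mem hθ
      exact hπ j hj hj
    intro k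
    induction k with
    | zero => exact fun _ => ⟨τ, rfl, fun j _ hj => absurd hj (Nat.not_lt_zero j)⟩
    | succ k ih =>
      intro hk
      obtain ⟨τ₁, hφ₁, hπ₁⟩ := ih (Nat.le_of_succ_le hk)
      have hk' : k < π.length := hk
      have hprev : ∀ χ ∈ π.take k, χ.eval τ₁ = true := by
        intro χ hχ
        obtain ⟨j, hj, rfl⟩ := List.getElem_of_mem hχ
        rw [List.length_take] at hj
        rw [List.getElem_take]
        exact hπ₁ j (by omega) (by omega)
      rcases h k hk' with ⟨r, hr, σ, hconc, hprem⟩ | ⟨p, ψ, hθ, hpψ, hpφ, hpπ⟩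
      · refine ⟨τ₁, hφ₁, fun j hj hjk => ?_⟩
        by_cases hjk' : j < k
        · exact hπ₁ j hj hjk'
        · obtain rfl : j = k := by omega
          rw [← hconc]
          exact (hF r hr).eval_subst σ τ₁ fun q hq => hprev _ (hprem q hq)
      · refine ⟨Function.update τ₁ p (ψ.eval τ₁), ?_, fun j hj hjk => ?_⟩
        · rw [eval_update_of_not_mem_vars hpφ, hφ₁]
        · by_cases hjk' : j < k
          · have hjt : j < (π.take k).length := by rw [List.length_take]; omega
            have hmem : π[j] ∈ π.take k := by
              have hm := List.getElem_mem hjt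
              rwa [List.getElem_take] at hm
            rw [eval_update_of_not_mem_vars (hpπ _ hmem)]
            exact hπ₁ j hj hjk'
          · obtain rfl : j = k := by omega
            rw [hθ, PropForm.eval_biimp, eval_update_of_not_mem_vars hpψ]
            simp [PropForm.eval]
  refine (mem_TAUT_iff φ).2 fun τ => ?_
  obtain ⟨τ', hφ, hπ⟩ := key _ _ hF.1 (sound_chkFn hc).1.1 τ
  rw [← hφ]
  exact hπ φ (List.mem_of_getLast? (sound_chkFn hc).1.2)

end Verifier

section Necessity

/-- Model bridge: `NP ⊆ P` (Cook–Karp classes) refutes `PneNP` (summit statement). [folklore] -/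
theorem not_pneNP_of_np_subset_p (h : Nondeterministic.NP ⊆ Classes.P) : ¬ PneNP := by
  rintro ⟨A, hA, hA'⟩
  rw [CookBridges.np_bool_eq] at hA
  rw [p_bool_eq] at hA'
  exact hA' (h hA)

/-- `TAUT ∈ P ⟹ NP ⊆ P` (`TAUT` is `coNP`-hard under Karp reductions; `P` is closed under complement). -/
theorem np_subset_p_of_TAUT_mem_P (h : TAUT ∈ Classes.P) : Nondeterministic.NP ⊆ Classes.P := by
  intro L hL
  have hc : Lᶜ ∈ coNP := by
    show Lᶜᶜ ∈ Nondeterministic.NP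
    rw [compl_compl]; exact hL
  exact compl_mem_P_iff.1 (mem_P_of_karpReducible_holds (CookLevin.isHard_coNP_TAUT_holds _ hc) h)

/-- A polynomial-time EF-prover over a Frege `F` puts `TAUT` in `P`. -/
theorem TAUT_mem_P_of_prover {F : FregeSystem} (hF : IsFrege F) {g : List Bool → List Bool} (hg : g ∈ FP)
    (hall : ∀ φ : PropForm ℕ, φ.IsTautology →
      chkFn F (boolPair (encodingPropForm.encode φ) (g (encodingPropForm.encode φ))) = [true]) :
    TAUT ∈ Classes.P := by
  set f : List Bool → List Bool := tautVerifierFn (efV F) ∘ fanoutFn id g with hf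
  have hfFP : f ∈ FP :=
    comp_mem_FP (tautVerifierFn_mem_FP (isPolyTimeVerifier_efV F))
      (fanoutFn_mem_FP (PolyTimeComputable.id _) hg)
  have hfx : ∀ x, f x = [efSys F x (g x)] := fun x => by
    show tautVerifierFn (efV F) (fanoutFn id g x) = _
    rw [fanoutFn_apply, tautVerifierFn_boolPair]
    rfl
  have hT : TAUT = {z | f z = [true]} := by
    ext x
    change x ∈ TAUT ↔ f x = [true]
    rw [hfx, List.singleton_inj]
    constructor
    · intro hx
      have h0 : chkTaut x [] = false := chkTaut_nil_eq_false_of_mem_TAUT hx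
      obtain ⟨φ, rfl⟩ := mem_range_encode_of_chkTaut_nil h0
      exact (efSys_eq_true_iff F _ _).2 ⟨h0, hall φ ((mem_TAUT_iff φ).1 hx)⟩
    · intro hx
      exact efSys_sound hF hx
  rw [hT]
  exact mem_P_of_boolValued hfFP fun z => by
    rw [hfx]
    cases efSys F z (g z) <;> simp

/-- **NECESSITY OF PIECE A** (stmt-PneNP-23777 is S-implied): `PneNP → NoFPProverEF`. -/
theorem noFPProverEF_of_pneNP (hS : PneNP) : RootDecompEfProver.NoFPProverEF := fun F hF ⟨g, hg, hall⟩ =>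
  not_pneNP_of_np_subset_p (np_subset_p_of_TAUT_mem_P (TAUT_mem_P_of_prover hF hg hall)) hS

end Necessity

end Summit.PneNP.PneNP.Theorems.RootDecompEfProverNoFPProverEFOfPneNP
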